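import Summits.Ventures.CertifiedManyBodySolver.Observables.SourcedGibbsTrialCapAFKSpace
import HarnessLib

/-!
# The AF–BCS sourced cap in momentum space (XVI-a): the particle NUMBER of the antiferromagnetic trial Gibbs state in
# momentum space (expectation level)

Cell hubbard-obs (seat hubbard-obs-pin-2). HONEST FRAMING: zero compute; the first of the two EXPECTATION-level
identities the thermodynamic-limit packaging of the certified AF–BCS cap needs (`AF-TL-PACKAGING.md`, step 4: the
`hrows` shape of the mixing bridge asks for the Gibbs-state number density and sourced energy of the trial matrix
separately, not only the ground-energy cap `groundEnergy_dWaveSourceTorus_le_AFBCS_kSpace`). For the AF trial matrix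
`B = A_{2k}(0, μ', h) + Σ_x M(−1)^x (n_{x↑} − n_{x↓})` (Hermitian: `isHermitian_dWaveSourceTorus_add_spinField`):
`⟨N⟩_{β,B} = Σ_p c₀₀(p) + (2k)² − Σ_p d₁₁(p)` with the closed-form coefficient sums of file (XIV-c1)
(`af_sum_density`). No number is claimed; not a statement about order; not a superconductivity verdict.

References: Bratteli–Robinson II §5.2.4 [BratteliRobinsonII1997]; Bach–Lieb–Solovej (1994) §2 [BachLiebSolovej1994];
Lieb (1989) proof of Theorem 2 [Lieb1989].
-/

noncomputable section

open Matrix Finset Literature.MathematicalPhysics.QuantumLattice Literature.Probability.LatticeModels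
open scoped ComplexConjugate

namespace Summit.Ventures.CertifiedManyBodySolver.Observables

variable (k : ℕ) [NeZero (2 * k)]

/-- **Number of the AF trial Gibbs state in momentum space**: for the trial matrix
`B = A_{2k}(0, μ', h) + Σ_x M(−1)^x(n_{x↑} − n_{x↓})` and every real `β`,
`⟨N_{2k}⟩_{β,B} = Σ_p c₀₀(p) + (2k)² − Σ_p d₁₁(p)` (closed forms of `af_sum_density`).
[cite: BratteliRobinsonII1997, §5.2.4] [cite: Lieb1989, proof of Theorem 2] -/
theorem gibbsState_afTrial_totalNumber_eq_kSpace (hL : 3 ≤ 2 * k) (μ' h M β : ℝ) :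
    gibbsState β (dWaveSourceTorus (2 * k) 0 μ' h +
        ∑ x : FermionTorus 2 (2 * k), ((M * neelSign x.toTorusSite : ℝ) : ℂ) • (numberOp x 0 - numberOp x 1)) totalNumber =
      (((∑ p : TorusSite 2 (2 * k), (1 / 2 -
          Real.tanh (β * Real.sqrt ((Real.sqrt (torusBand (2 * k) p ^ 2 + M ^ 2) + |μ'|) ^ 2 + (2 * Real.sqrt 2 * h * dWaveGap p) ^ 2) / 2) /
              (2 * Real.sqrt ((Real.sqrt (torusBand (2 * k) p ^ 2 + M ^ 2) + |μ'|) ^ 2 + (2 * Real.sqrt 2 * h * dWaveGap p) ^ 2)) *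
            ((torusBand (2 * k) p - μ') / 2 - μ' / (2 * |μ'| * Real.sqrt (torusBand (2 * k) p ^ 2 + M ^ 2)) *
              (torusBand (2 * k) p ^ 2 + M ^ 2 - torusBand (2 * k) p * μ')) -
          Real.tanh (β * Real.sqrt ((Real.sqrt (torusBand (2 * k) p ^ 2 + M ^ 2) - |μ'|) ^ 2 + (2 * Real.sqrt 2 * h * dWaveGap p) ^ 2) / 2) /
              (2 * Real.sqrt ((Real.sqrt (torusBand (2 * k) p ^ 2 + M ^ 2) - |μ'|) ^ 2 + (2 * Real.sqrt 2 * h * dWaveGap p) ^ 2)) *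
            ((torusBand (2 * k) p - μ') / 2 + μ' / (2 * |μ'| * Real.sqrt (torusBand (2 * k) p ^ 2 + M ^ 2)) *
              (torusBand (2 * k) p ^ 2 + M ^ 2 - torusBand (2 * k) p * μ')))) + ((2 * k : ℕ) : ℝ) ^ 2 - (∑ p : TorusSite 2 (2 * k), (1 / 2 +
          Real.tanh (β * Real.sqrt ((Real.sqrt (torusBand (2 * k) p ^ 2 + M ^ 2) + |μ'|) ^ 2 + (2 * Real.sqrt 2 * h * dWaveGap p) ^ 2) / 2) /
              (2 * Real.sqrt ((Real.sqrt (torusBand (2 * k) p ^ 2 + M ^ 2) + |μ'|) ^ 2 + (2 * Real.sqrt 2 * h * dWaveGap p) ^ 2)) *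
            ((torusBand (2 * k) p - μ') / 2 - μ' / (2 * |μ'| * Real.sqrt (torusBand (2 * k) p ^ 2 + M ^ 2)) *
              (torusBand (2 * k) p ^ 2 + M ^ 2 - torusBand (2 * k) p * μ')) +
          Real.tanh (β * Real.sqrt ((Real.sqrt (torusBand (2 * k) p ^ 2 + M ^ 2) - |μ'|) ^ 2 + (2 * Real.sqrt 2 * h * dWaveGap p) ^ 2) / 2) /
              (2 * Real.sqrt ((Real.sqrt (torusBand (2 * k) p ^ 2 + M ^ 2) - |μ'|) ^ 2 + (2 * Real.sqrt 2 * h * dWaveGap p) ^ 2)) *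
            ((torusBand (2 * k) p - μ') / 2 + μ' / (2 * |μ'| * Real.sqrt (torusBand (2 * k) p ^ 2 + M ^ 2)) *
              (torusBand (2 * k) p ^ 2 + M ^ 2 - torusBand (2 * k) p * μ')))) : ℝ) : ℂ) := by
  have hconj := spinFieldTorus_conj_nambu (2 * k) μ' h (fun x => M * neelSign x.toTorusSite)
  have key := gibbsState_totalNumber_of_conj (Λ := FermionTorus 2 (2 * k))
    (isHermitian_dWaveNambu_add_spinField (2 * k) μ' h (fun x => M * neelSign x.toTorusSite))
    (c := (μ' : ℂ) * ((2 * k : ℕ) : ℂ) ^ 2 + ∑ x : FermionTorus 2 (2 * k), ((M * neelSign x.toTorusSite : ℝ) : ℂ))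
    (by convert hconj using 7) β
  rw [← af_sum_density k hL μ' h M β]
  convert key using 40

end Summit.Ventures.CertifiedManyBodySolver.Observables
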